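import Literature.AnabelianGeometry.EtaleTheta.SettingModelTateRigidityOfRecordClosed
import Literature.AnabelianGeometry.EtaleTheta.SettingModelTateInstance
import Literature.AnabelianGeometry.EtaleTheta.SettingModelCyclotomeModPred
import Literature.AnabelianGeometry.EtaleTheta.SettingModelTateCyclotomes
import Literature.IUT.HodgeArakelov.MonoThetaFromGroupsProofs3b
import Literature.IUT.HodgeArakelov.BadPlaceSettingOfUnderline
import Literature.IUT.HodgeArakelov.ModelDef11OutputOfOrigin
import Literature.IUT.HodgeArakelov.ModelCyclotomesZHat
import Literature.IUT.HodgeArakelov.ModelReconstructionInvarianceTate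
import HarnessLib

/-!
# The [IUTchII] §1/§2 GENUINE CARRIERS `ThetaSetting.ofDoubleUnderline` / `BadPlaceSetting.ofUnderline` AT THE
# [EtTh] TATE MODEL `ThetaSetting.modelTate p` — every `Prop` binder discharged (proof-only; D-0079 K-L6)

S. Mochizuki, *Inter-universal Teichmüller theory II*, kurims manuscript (Dec. 2020), §1 p. 20 (the setting:
"`l` an odd prime", "`p` odd, `p ≠ l`", "`k` contains a primitive `4l`-th root of unity"), Def. 1.1 pp. 20–21,
Prop. 1.2 (i), (ii) pp. 25–26, §2 p. 64 / Prop. 2.1 pp. 64–65 [claim: Mochizuki2012, status: disputed]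
(IUTchII §1 Prop 1.2 (i), kurims p.25); S. Mochizuki, *The étale theta function …*, Publ. RIMS **45** (2009)
[EtTh], §1 pp. 11–14, Def. 2.5 p. 39 ("`K = K̈`"), Def. 2.13 p. 46 (PRIMS PDF pages)
[cite: MochizukiEtTh2009, Def 2.13 p.46]; J.-P. Serre, *A Course in Arithmetic*, Ch. II §3.1 Prop. 7, Corollary
("`ℚ_p` contains the `(p−1)`-th roots of unity") [cite: Serre1973, Ch. II §3.1 Prop. 7].
Cell `abc-iut`, seat abc-iut-w5-d233 (gen 5); D-0079 programme L-K, K-L6 slice «hypothesis bundle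
`ThetaSetting.Sec2Hyps` — genuine-instance constructions (ThetaSetting / BadPlaceSetting at the [EtTh] models)»
(abc-iut-L6-lead 13:21:50Z; census abc-iut-w5-d109 `L6-SLICE-INPUT-CENSUS.md` d889dbec7c7c1df3 / abc-iut-w5-d012 v2
ca24e4516e42b12c: `Sec2Hyps` binds the index conjuncts of II:Prop1.2(i), (ii), Prop1.5(i)–(iii), Prop2.1,
Prop2.2(i)).  PROOF-ONLY: no definition, no instance, no new named fact; every input consumed BY NAME.

STATE OF RECORD.  The [IUTchII] §1/§2 carriers of the Tate curve over an [EtTh] §1 theta setting `D` —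
`ThetaSetting.ofDoubleUnderline C μ hC hS hl hp2 hpl hζ hη` (bridge B8, abc-iut-L6-d6/L6-t1) and the print-level
bad-place setting `BadPlaceSetting.ofUnderline C μ hC hS hl hp2 hpl hζ hη` (abc-iut-L6-t19) — carry the binders
`E` (étale-theta datum), `C` (choice of `X̲̲`), `μ` (cyclotome identification), `hC : D.Compat`, `hS : D.Sec2Hyps`,
the printed side conditions `hl, hp2, hpl, hζ`, and a theta cocycle `hη`; their consumers (abc-iut-L6-d6 / w4-d008 /
f-150) add `h15 : Prop15iii`, `L : CuspLabels`, `IsEtThOrigin`, `hYcl`.  abc-iut-f-150's `…AtModelChi` capstones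
discharge `IsEtThOrigin`, `hYcl`, temp-slimness and `IsOpenMap aug` at the χ-model but keep
`E, C, μ, hC, hS, h15, L, hζ, η, hη` as binders.

THIS FILE.  At the stage-2 Tate model `ThetaSetting.modelTate p = modelχq p 1 2` (abc-iut-L2-t5; `K = ℚ_p`,
`q_X = p²`, `Π^tp_X = (F̂₂ ×_Ẑ ℤ) ⋊ G_{ℚ_p}`) EVERY `Prop` binder is a theorem of the tree, consumed by name:
`hC` (`compat_modelχq`, abc-iut-f-149), `hS` (`ThetaSetting.modelχq_sec2Hyps`, abc-iut-L2-t8),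
`IsEtThOrigin` / `hYcl` (`modelχq_isEtThOrigin`, `hYcl_modelχq`, abc-iut-L2-t5), `h15` at the `inr`-section
étale-theta datum of record carrying `η̈♯ = etaDdχq` (abc-iut-L2-t6 `prop15iii_etaleThetaDataOfClass_etaDdχq`, over
abc-iut-w5-d171's `kummerCoreχq`), the choice `X̲̲` with `Π^tp_X̲̲ = Huuχq` (abc-iut-L2-d1
`doubleUnderlineχqOfEtaRes` + `eta_res_etaDdχq`), the empty cusp labelling, and — NEW here —
* `hζ` («`K ∋ ζ_{4l}`») from the ARITHMETIC side condition `4l ∣ p − 1` alone (`exists_isPrimitiveRoot_K_modelχq`,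
  over abc-iut-w5-d125's Hensel root `exists_isPrimitiveRoot_padic_of_dvd_pred`; `4l ∣ p − 1` also forces
  `p ≠ 2`, `p ≠ l`);
* `hη` (a theta cocycle) for EVERY setting: the mod-`N` reduction of abc-iut-L6-t1's one-root lift `rootLift C`
  (abc-iut-w4-d010 `EtaleThetaDataOfSetting.modN_rootLift_mem_thetaCocycles`).
Hence, for every prime `p`, odd prime `l` with `4l ∣ p − 1`, level `N` and cyclotome identification `μ` (DATA;
inhabited: abc-iut-L2-t8 `modelχq_nonempty_cyclotomeMod`), the carriers `ThetaSetting.ofDoubleUnderline …` and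
`BadPlaceSetting.ofUnderline …` are kernel objects with NO `Prop` binder left, and at them:
`nonempty_modelFrame_modelTate` / `nonempty_def11Output_modelTate` (II:Def1.1), `nonempty_envOfGroup_modelTate` /
`prop12_i_indeterminacy_envOfGroup_modelTate` / `exists_envOfGroup_indeterminacy_modelTate` (II:Prop1.2(i)),
`exists_envOfFrobenioid_indeterminacy_modelTate` (II:Prop1.2(ii)), `nonempty_monoThetaEnv_modelTate`,
`ofUnderline_index_eq_modelTate` (`[Π^tp_{X_v} : Π_v] = l`), and II:Prop2.1 well-definedness
`YL_eq_of_piYddCharacteristic_modelTate` modulo the ONE tempered-anabelian input (H1)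
`EtaleThetaDataOfSetting.PiYddCharacteristic` at the instance (named residual, not discharged here); census form
`ThetaSetting.exists_isEtThOrigin_sec2Hyps_carriers` (∃ a theta setting with `IsEtThOrigin ∧ Sec2Hyps` carrying all of
the above).

HONEST LABEL: `modelTate` is a SEMI-SYNTHETIC model of the typed [EtTh] §1 interface (not the tempered `π₁` of a
curve): joint-satisfiability / non-vacuity evidence for the binders of the [IUTchII] §1/§2 carriers, i.e. OUR kernel
check that the hypothesis bundle `Sec2Hyps` and its companions are realised TOGETHER at one genuine (non-toy) carrier;
the [IUTchII] claim key `Mochizuki2012` is DISPUTED (D-0012) and nothing of it is asserted; nothing of [EtTh] /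
[Serre] is asserted beyond the tree's proofs; no side is taken on [IUTchIII] Cor. 3.12; typed ≠ proved; nothing here
says abc is proved or refuted.
-/

noncomputable section

namespace Literature.IUT.HodgeArakelov

open Literature.AnabelianGeometry.EtaleTheta Literature.AnabelianGeometry.SemiGraphs
open Literature.AnabelianGeometry.EtaleTheta.SettingModel
open scoped Literature.AnabelianGeometry.EtaleTheta

namespace ModelTateCarriers

variable (p : ℕ) [Fact p.Prime]

/-! ## §1. The arithmetic side conditions of [IUTchII] §1 p. 20 at `K = ℚ_p` -/

/-- **`ℚ_p ∋` a primitive `n`-th root of unity for every `n ∣ p − 1`**, as an element of the bottom intermediate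
field `⊥ = ℚ_p ⊆ ℚ̄_p` (the `K` of every [EtTh] model of the tree): abc-iut-w5-d125's Hensel root transported along
`botEquiv`. [cite: Serre1973, Ch. II §3.1 Prop. 7] -/
theorem exists_isPrimitiveRoot_bot_of_dvd_pred (n : ℕ+) (hn : (n : ℕ) ∣ p - 1) :
    ∃ ζ : (⊥ : IntermediateField ℚ_[p] (PadicAlgCl p)), IsPrimitiveRoot ζ n := by
  obtain ⟨ζ, hζ⟩ := exists_isPrimitiveRoot_padic_of_dvd_pred p n hn
  exact ⟨(IntermediateField.botEquiv ℚ_[p] (PadicAlgCl p)).symm ζ,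
    hζ.map_of_injective (IntermediateField.botEquiv ℚ_[p] (PadicAlgCl p)).symm.injective⟩

/-- `4l ∣ p − 1` with `l ≥ 1` forces `p ≠ 2` ("`p` odd"). [claim: Mochizuki2012, status: disputed] (IUTchII §1, kurims p.20) -/
theorem ne_two_of_four_mul_dvd_pred {l : ℕ} (hl : 0 < l) (h : 4 * l ∣ p - 1) : p ≠ 2 := by
  rintro rfl
  have := Nat.le_of_dvd (by norm_num) h
  omega

/-- `4l ∣ p − 1` with `l ≥ 1` forces `p ≠ l` ([IUTchII] §1 p. 20). [claim: Mochizuki2012, status: disputed] (IUTchII §1, kurims p.20) -/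
theorem ne_of_four_mul_dvd_pred {l : ℕ} (hl : 0 < l) (h : 4 * l ∣ p - 1) : p ≠ l := by
  rintro rfl
  have hp : 0 < p - 1 := by have := (Fact.out : p.Prime).two_le; omega
  have := Nat.le_of_dvd hp h
  omega

/-- **`hζ` at the stage-2 models**: for `4l ∣ p − 1` the base field `K = ℚ_p` of `ThetaSetting.modelχq p i j`
contains a primitive `4l`-th root of unity ("`k` contains a primitive `4l`-th root of unity", [IUTchII] §1 p. 20).
[cite: Serre1973, Ch. II §3.1 Prop. 7] -/
theorem exists_isPrimitiveRoot_K_modelχq (i j : ℤ) (hj : Even j) {l : ℕ} (hl : 0 < l) (h : 4 * l ∣ p - 1) :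
    ∃ ζ : (ThetaSetting.modelχq p i j hj).K, IsPrimitiveRoot ζ (4 * l) :=
  exists_isPrimitiveRoot_bot_of_dvd_pred p ⟨4 * l, by omega⟩ h

/-! ## §2. The carriers of record at `modelTate p = modelχq p 1 2` and the [IUTchII] §1 rows there

Throughout: `l` an odd prime with `4l ∣ p − 1`, a level `N`, a cyclotome identification `μ` (DATA).  The `let`-bound
`C` is the choice `X̲̲` of record over the `inr`-section étale-theta datum carrying `η̈♯`; `S` / `B` are the [IUTchII]
§1 setting / bad-place setting of the Tate curve built from it with EVERY `Prop` argument a named theorem. -/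

variable (l : ℕ+) (hl : Odd (l : ℕ)) (hlp : (l : ℕ).Prime) (hdvd : 4 * (l : ℕ) ∣ p - 1) {N : ℕ+}
  (μ : (ThetaSetting.modelχq p 1 2 even_two).CyclotomeMod l N)

/-- `Π^tp_{X̲̲_v}` of the carrier of record IS `Huuχq p 1 2 l` (abc-iut-L2-d1's `X̲̲` at the Tate model), on the nose.
[cite: MochizukiEtTh2009, Def 2.5 (i) p.39] -/
theorem ofDoubleUnderline_PiX_modelTate :
    let C := (((kummerCoreχq p 1 2 even_two).toKummerDataOfSection SemidirectProduct.inr (continuous_inrχq p 1 2)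
        (fun _ => rfl) (map_inr_GK_le_GtpY_modelχq' p 1 2 even_two)
        (map_inr_GKdd_le_GtpYdd_modelχq' p 1 2 even_two)).etaleThetaDataOfClass
        (etaDdχq p 1 2 even_two)).doubleUnderlineχqOfEtaRes p 1 2 l hl (eta_res_etaDdχq p 1 2 even_two l hl)
    let S := ThetaSetting.ofDoubleUnderline C μ (compat_modelχq p 1 2 even_two)
        (ThetaSetting.modelχq_sec2Hyps p 1 2 even_two) hlp (ne_two_of_four_mul_dvd_pred p l.pos hdvd)
        (ne_of_four_mul_dvd_pred p l.pos hdvd) (exists_isPrimitiveRoot_K_modelχq p 1 2 even_two l.pos hdvd)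
        (EtaleThetaDataOfSetting.modN_rootLift_mem_thetaCocycles C (compat_modelχq p 1 2 even_two)
          (ThetaSetting.modelχq_sec2Hyps p 1 2 even_two) μ)
    (S.PiX : Type) = Huuχq p 1 2 l hl ∧ S.N = N := by
  intro C S
  exact ⟨rfl, rfl⟩

/-- **II:Def1.1 (i) — the `ModelFrame` of the Tate curve of the Tate model is inhabited, NO `Prop` binder**
(abc-iut-L6-d6's `nonempty_modelFrame_ofDoubleUnderline` with every argument a theorem of the tree).
[claim: Mochizuki2012, status: disputed] (IUTchII §1 Def 1.1 (i), kurims pp.20-21) -/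
theorem nonempty_modelFrame_modelTate :
    let K₀ := (kummerCoreχq p 1 2 even_two).toKummerDataOfSection SemidirectProduct.inr (continuous_inrχq p 1 2)
        (fun _ => rfl) (map_inr_GK_le_GtpY_modelχq' p 1 2 even_two) (map_inr_GKdd_le_GtpYdd_modelχq' p 1 2 even_two)
    let C := (K₀.etaleThetaDataOfClass (etaDdχq p 1 2 even_two)).doubleUnderlineχqOfEtaRes p 1 2 l hl
        (eta_res_etaDdχq p 1 2 even_two l hl)
    let h15 := prop15iii_etaleThetaDataOfClass_etaDdχq p (compat_modelχq p 1 2 even_two) SemidirectProduct.inr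
        (continuous_inrχq p 1 2) (fun _ => rfl) (map_inr_GK_le_GtpY_modelχq' p 1 2 even_two)
        (map_inr_GKdd_le_GtpYdd_modelχq' p 1 2 even_two)
    let S := ThetaSetting.ofDoubleUnderline C μ (compat_modelχq p 1 2 even_two)
        (ThetaSetting.modelχq_sec2Hyps p 1 2 even_two) hlp (ne_two_of_four_mul_dvd_pred p l.pos hdvd)
        (ne_of_four_mul_dvd_pred p l.pos hdvd) (exists_isPrimitiveRoot_K_modelχq p 1 2 even_two l.pos hdvd)
        (EtaleThetaDataOfSetting.modN_rootLift_mem_thetaCocycles C (compat_modelχq p 1 2 even_two)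
          (ThetaSetting.modelχq_sec2Hyps p 1 2 even_two) μ)
    Nonempty (ModelFrame S (C.rigidData μ (compat_modelχq p 1 2 even_two)
      (ThetaSetting.modelχq_sec2Hyps p 1 2 even_two) h15 ⟨fun _ => ∅, fun _ => ∅, fun _ => rfl⟩)) := by
  intro K₀ C h15 S
  exact ThetaSetting.nonempty_modelFrame_ofDoubleUnderline C μ _ _ h15 _ hlp _ _ _ _
    (ThetaSetting.modelχq_isEtThOrigin p 1 2 even_two) (hYcl_modelχq p 1 2 even_two)

/-- **II:Def1.1 — the Def. 1.1 output EXISTS for every mono-theta environment of the Tate curve of the Tate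
model, NO `Prop` binder** (abc-iut-L6-d6's `nonempty_def11Output_ofDoubleUnderline_of_origin`).
[claim: Mochizuki2012, status: disputed] (IUTchII §1 Def 1.1, kurims pp.20-21) -/
theorem nonempty_def11Output_modelTate :
    let C := (((kummerCoreχq p 1 2 even_two).toKummerDataOfSection SemidirectProduct.inr (continuous_inrχq p 1 2)
        (fun _ => rfl) (map_inr_GK_le_GtpY_modelχq' p 1 2 even_two)
        (map_inr_GKdd_le_GtpYdd_modelχq' p 1 2 even_two)).etaleThetaDataOfClass
        (etaDdχq p 1 2 even_two)).doubleUnderlineχqOfEtaRes p 1 2 l hl (eta_res_etaDdχq p 1 2 even_two l hl)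
    let S := ThetaSetting.ofDoubleUnderline C μ (compat_modelχq p 1 2 even_two)
        (ThetaSetting.modelχq_sec2Hyps p 1 2 even_two) hlp (ne_two_of_four_mul_dvd_pred p l.pos hdvd)
        (ne_of_four_mul_dvd_pred p l.pos hdvd) (exists_isPrimitiveRoot_K_modelχq p 1 2 even_two l.pos hdvd)
        (EtaleThetaDataOfSetting.modN_rootLift_mem_thetaCocycles C (compat_modelχq p 1 2 even_two)
          (ThetaSetting.modelχq_sec2Hyps p 1 2 even_two) μ)
    ∀ M : MonoThetaEnv S, Nonempty (Def11Output M) := by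
  intro C S M
  exact ThetaSetting.nonempty_def11Output_ofDoubleUnderline_of_origin C μ _ _
    (prop15iii_etaleThetaDataOfClass_etaDdχq p (compat_modelχq p 1 2 even_two) SemidirectProduct.inr
      (continuous_inrχq p 1 2) (fun _ => rfl) (map_inr_GK_le_GtpY_modelχq' p 1 2 even_two)
      (map_inr_GKdd_le_GtpYdd_modelχq' p 1 2 even_two))
    ⟨fun _ => ∅, fun _ => ∅, fun _ => rfl⟩ hlp _ _ _ _ (ThetaSetting.modelχq_isEtThOrigin p 1 2 even_two)
    (hYcl_modelχq p 1 2 even_two) M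

/-- **The structure `MonoThetaEnv S` of [IUTchII] §1 Def. 1.1 is INHABITED at the Tate model by the [EtTh] Def. 2.13 (ii)
model environment of the Tate curve** (bridge B8 `nonempty_monoThetaEnv_ofDoubleUnderline`, unconditional), so the
`∀ M` of `nonempty_def11Output_modelTate` is not vacuous. [cite: MochizukiEtTh2009, Def 2.13 p.46] -/
theorem nonempty_monoThetaEnv_modelTate :
    let C := (((kummerCoreχq p 1 2 even_two).toKummerDataOfSection SemidirectProduct.inr (continuous_inrχq p 1 2)
        (fun _ => rfl) (map_inr_GK_le_GtpY_modelχq' p 1 2 even_two)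
        (map_inr_GKdd_le_GtpYdd_modelχq' p 1 2 even_two)).etaleThetaDataOfClass
        (etaDdχq p 1 2 even_two)).doubleUnderlineχqOfEtaRes p 1 2 l hl (eta_res_etaDdχq p 1 2 even_two l hl)
    let hη := EtaleThetaDataOfSetting.modN_rootLift_mem_thetaCocycles C (compat_modelχq p 1 2 even_two)
        (ThetaSetting.modelχq_sec2Hyps p 1 2 even_two) μ
    let S := ThetaSetting.ofDoubleUnderline C μ (compat_modelχq p 1 2 even_two)
        (ThetaSetting.modelχq_sec2Hyps p 1 2 even_two) hlp (ne_two_of_four_mul_dvd_pred p l.pos hdvd)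
        (ne_of_four_mul_dvd_pred p l.pos hdvd) (exists_isPrimitiveRoot_K_modelχq p 1 2 even_two l.pos hdvd) hη
    ∃ M : MonoThetaEnv S, M.toEtale = (C.thetaEnvData μ (compat_modelχq p 1 2 even_two)
      (ThetaSetting.modelχq_sec2Hyps p 1 2 even_two)).modelMono hη := by
  intro C hη S
  exact ThetaSetting.nonempty_monoThetaEnv_ofDoubleUnderline C μ _ _ hlp _ _ _ hη

/-- **II:Prop1.2(i) — the output `Π ↦ M^Θ(Π)` EXISTS at the Tate curve of the Tate model for every topological group
`Π ≅ Π^tp_{X̲̲}`, NO `Prop` binder** (abc-iut-L6-d6's `nonempty_envOfGroup_ofDoubleUnderline_of_origin` with every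
argument a theorem of the tree). [claim: Mochizuki2012, status: disputed] (IUTchII §1 Prop 1.2 (i), kurims p.25) -/
theorem nonempty_envOfGroup_modelTate (P : TopGroup.{0}) :
    let C := (((kummerCoreχq p 1 2 even_two).toKummerDataOfSection SemidirectProduct.inr (continuous_inrχq p 1 2)
        (fun _ => rfl) (map_inr_GK_le_GtpY_modelχq' p 1 2 even_two)
        (map_inr_GKdd_le_GtpYdd_modelχq' p 1 2 even_two)).etaleThetaDataOfClass
        (etaDdχq p 1 2 even_two)).doubleUnderlineχqOfEtaRes p 1 2 l hl (eta_res_etaDdχq p 1 2 even_two l hl)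
    let S := ThetaSetting.ofDoubleUnderline C μ (compat_modelχq p 1 2 even_two)
        (ThetaSetting.modelχq_sec2Hyps p 1 2 even_two) hlp (ne_two_of_four_mul_dvd_pred p l.pos hdvd)
        (ne_of_four_mul_dvd_pred p l.pos hdvd) (exists_isPrimitiveRoot_K_modelχq p 1 2 even_two l.pos hdvd)
        (EtaleThetaDataOfSetting.modN_rootLift_mem_thetaCocycles C (compat_modelχq p 1 2 even_two)
          (ThetaSetting.modelχq_sec2Hyps p 1 2 even_two) μ)
    ∀ _hP : Nonempty (P ≃ₜ* S.PiX), Nonempty (EnvOfGroup S P) := by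
  intro C S hP
  exact ThetaSetting.nonempty_envOfGroup_ofDoubleUnderline_of_origin C μ _ _
    (prop15iii_etaleThetaDataOfClass_etaDdχq p (compat_modelχq p 1 2 even_two) SemidirectProduct.inr
      (continuous_inrχq p 1 2) (fun _ => rfl) (map_inr_GK_le_GtpY_modelχq' p 1 2 even_two)
      (map_inr_GKdd_le_GtpYdd_modelχq' p 1 2 even_two))
    ⟨fun _ => ∅, fun _ => ∅, fun _ => rfl⟩ hlp _ _ _ _ (ThetaSetting.modelχq_isEtThOrigin p 1 2 even_two)
    (hYcl_modelχq p 1 2 even_two) P hP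

/-- **II:Prop1.2(i), indeterminacy clause at the Tate model, NO `Prop` binder**: for every `Π ≅ Π^tp_{X̲̲}`, bridge B8's
chosen `M^Θ(Π)` (cyclotome input supplied at the origin `modelTate`) has the printed isomorphism indeterminacy — `1`
(`N` odd) resp. `2` (`N` even) `μ_N`-conjugacy classes (abc-iut-L6-d6's
`prop12_i_indeterminacy_envOfGroup_ofDoubleUnderline_of_origin`).
[claim: Mochizuki2012, status: disputed] (IUTchII §1 Prop 1.2 (i), kurims p.25) -/
theorem prop12_i_indeterminacy_envOfGroup_modelTate (P : TopGroup.{0}) :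
    let hC := compat_modelχq p 1 2 even_two
    let hS := ThetaSetting.modelχq_sec2Hyps p 1 2 even_two
    let K₀ := (kummerCoreχq p 1 2 even_two).toKummerDataOfSection SemidirectProduct.inr (continuous_inrχq p 1 2)
        (fun _ => rfl) (map_inr_GK_le_GtpY_modelχq' p 1 2 even_two) (map_inr_GKdd_le_GtpYdd_modelχq' p 1 2 even_two)
    let C := (K₀.etaleThetaDataOfClass (etaDdχq p 1 2 even_two)).doubleUnderlineχqOfEtaRes p 1 2 l hl
        (eta_res_etaDdχq p 1 2 even_two l hl)
    let h15 : Literature.AnabelianGeometry.EtaleTheta.ThetaSetting.Prop15iii _ hC :=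
      prop15iii_etaleThetaDataOfClass_etaDdχq p hC SemidirectProduct.inr
        (continuous_inrχq p 1 2) (fun _ => rfl) (map_inr_GK_le_GtpY_modelχq' p 1 2 even_two)
        (map_inr_GKdd_le_GtpYdd_modelχq' p 1 2 even_two)
    let L : C.CuspLabels := ⟨fun _ => ∅, fun _ => ∅, fun _ => rfl⟩
    let hO := ThetaSetting.modelχq_isEtThOrigin p 1 2 even_two
    let hYcl := hYcl_modelχq p 1 2 even_two
    let hp2 := ne_two_of_four_mul_dvd_pred p l.pos hdvd
    let hpl := ne_of_four_mul_dvd_pred p l.pos hdvd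
    let hζ := exists_isPrimitiveRoot_K_modelχq p 1 2 even_two l.pos hdvd
    let hη := EtaleThetaDataOfSetting.modN_rootLift_mem_thetaCocycles C hC hS μ
    let S := ThetaSetting.ofDoubleUnderline C μ hC hS hlp hp2 hpl hζ hη
    ∀ hP : Nonempty (P ≃ₜ* S.PiX),
      Prop12_i_indeterminacy (ThetaSetting.envOfGroup (C.rigidData μ hC hS h15 L)
        (ThetaSetting.SideData.ofDoubleUnderline C μ hC hS hlp hp2 hpl hζ hη)
        (ThetaSetting.t1Space_Huu C) (ThetaSetting.isClosed_ker_aug_thetaEnvData C μ hC hS)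
        (ModelCyclotomes.nonempty_lDeltaQuot_rigidData_mulEquiv_zHat C μ hC hS h15 L hO hYcl hlp.ne_zero) P hP).recon := by
  intro hC hS K₀ C h15 L hO hYcl hp2 hpl hζ hη S hP
  exact ThetaSetting.prop12_i_indeterminacy_envOfGroup_ofDoubleUnderline_of_origin C μ hC hS h15 L hlp hp2 hpl hζ hη
    hO hYcl P hP

/-- **II:Prop1.2(i), census form at the Tate model, NO `Prop` binder**: for every `Π ≅ Π^tp_{X̲̲}` SOME `M^Θ(Π)` with the
printed indeterminacy exists (abc-iut-L6-d6's `exists_envOfGroup_indeterminacy_ofDoubleUnderline_of_origin`).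
[claim: Mochizuki2012, status: disputed] (IUTchII §1 Prop 1.2 (i), kurims p.25) -/
theorem exists_envOfGroup_indeterminacy_modelTate (P : TopGroup.{0}) :
    let C := (((kummerCoreχq p 1 2 even_two).toKummerDataOfSection SemidirectProduct.inr (continuous_inrχq p 1 2)
        (fun _ => rfl) (map_inr_GK_le_GtpY_modelχq' p 1 2 even_two)
        (map_inr_GKdd_le_GtpYdd_modelχq' p 1 2 even_two)).etaleThetaDataOfClass
        (etaDdχq p 1 2 even_two)).doubleUnderlineχqOfEtaRes p 1 2 l hl (eta_res_etaDdχq p 1 2 even_two l hl)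
    let S := ThetaSetting.ofDoubleUnderline C μ (compat_modelχq p 1 2 even_two)
        (ThetaSetting.modelχq_sec2Hyps p 1 2 even_two) hlp (ne_two_of_four_mul_dvd_pred p l.pos hdvd)
        (ne_of_four_mul_dvd_pred p l.pos hdvd) (exists_isPrimitiveRoot_K_modelχq p 1 2 even_two l.pos hdvd)
        (EtaleThetaDataOfSetting.modN_rootLift_mem_thetaCocycles C (compat_modelχq p 1 2 even_two)
          (ThetaSetting.modelχq_sec2Hyps p 1 2 even_two) μ)
    ∀ _hP : Nonempty (P ≃ₜ* S.PiX), ∃ Env : EnvOfGroup S P, Prop12_i_indeterminacy Env.recon := by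
  intro C S hP
  exact ThetaSetting.exists_envOfGroup_indeterminacy_ofDoubleUnderline_of_origin C μ _ _
    (prop15iii_etaleThetaDataOfClass_etaDdχq p (compat_modelχq p 1 2 even_two) SemidirectProduct.inr
      (continuous_inrχq p 1 2) (fun _ => rfl) (map_inr_GK_le_GtpY_modelχq' p 1 2 even_two)
      (map_inr_GKdd_le_GtpYdd_modelχq' p 1 2 even_two))
    ⟨fun _ => ∅, fun _ => ∅, fun _ => rfl⟩ hlp _ _ _ _ (ThetaSetting.modelχq_isEtThOrigin p 1 2 even_two)
    (hYcl_modelχq p 1 2 even_two) P hP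

/-- **II:Prop1.2(ii) at the Tate model, NO `Prop` binder**: for every tempered-Frobenioid datum `Fr` and every mono-theta
environment `M` of the Tate curve of the Tate model, the output `M^Θ(𝒞)` EXISTS with `env = M` and the printed
indeterminacy (abc-iut-L6-d6's `exists_envOfFrobenioid_indeterminacy_ofDoubleUnderline_of_origin`).
[claim: Mochizuki2012, status: disputed] (IUTchII §1 Prop 1.2 (ii), kurims p.26) -/
theorem exists_envOfFrobenioid_indeterminacy_modelTate :
    let C := (((kummerCoreχq p 1 2 even_two).toKummerDataOfSection SemidirectProduct.inr (continuous_inrχq p 1 2)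
        (fun _ => rfl) (map_inr_GK_le_GtpY_modelχq' p 1 2 even_two)
        (map_inr_GKdd_le_GtpYdd_modelχq' p 1 2 even_two)).etaleThetaDataOfClass
        (etaDdχq p 1 2 even_two)).doubleUnderlineχqOfEtaRes p 1 2 l hl (eta_res_etaDdχq p 1 2 even_two l hl)
    let S := ThetaSetting.ofDoubleUnderline C μ (compat_modelχq p 1 2 even_two)
        (ThetaSetting.modelχq_sec2Hyps p 1 2 even_two) hlp (ne_two_of_four_mul_dvd_pred p l.pos hdvd)
        (ne_of_four_mul_dvd_pred p l.pos hdvd) (exists_isPrimitiveRoot_K_modelχq p 1 2 even_two l.pos hdvd)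
        (EtaleThetaDataOfSetting.modN_rootLift_mem_thetaCocycles C (compat_modelχq p 1 2 even_two)
          (ThetaSetting.modelχq_sec2Hyps p 1 2 even_two) μ)
    ∀ (Fr : TemperedFrobenioidData S) (M : MonoThetaEnv S),
      ∃ Env : EnvOfFrobenioid Fr, Env.env = M ∧ Prop12_i_indeterminacy Env.recon := by
  intro C S Fr M
  exact ThetaSetting.exists_envOfFrobenioid_indeterminacy_ofDoubleUnderline_of_origin C μ _ _
    (prop15iii_etaleThetaDataOfClass_etaDdχq p (compat_modelχq p 1 2 even_two) SemidirectProduct.inr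
      (continuous_inrχq p 1 2) (fun _ => rfl) (map_inr_GK_le_GtpY_modelχq' p 1 2 even_two)
      (map_inr_GKdd_le_GtpYdd_modelχq' p 1 2 even_two))
    ⟨fun _ => ∅, fun _ => ∅, fun _ => rfl⟩ hlp _ _ _ _ (ThetaSetting.modelχq_isEtThOrigin p 1 2 even_two)
    (hYcl_modelχq p 1 2 even_two) Fr M

/-! ## §3. The print-level bad-place setting `BadPlaceSetting.ofUnderline` at the Tate model ([IUTchII] §2 p. 64) -/

/-- **The [IUTchII] §2 bad-place setting of the Tate curve of the Tate model** (abc-iut-L6-t19's print-level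
`BadPlaceSetting.ofUnderline`, `Π^tp_{X_v} := Π^tp_{X̲}`), NO `Prop` binder: `Π_v = Huuχq`, `Π^tp_{X_v} = Π^tp_{X̲} = toZ⁻¹(l·ℤ)`
of the Tate model, and the printed index `[Π^tp_{X_v} : Π_v] = l` ([IUTchII] Def. 2.3 (i)).
[claim: Mochizuki2012, status: disputed] (IUTchII §2 Prop 2.1, kurims p.64) -/
theorem ofUnderline_PiX_index_modelTate :
    let C := (((kummerCoreχq p 1 2 even_two).toKummerDataOfSection SemidirectProduct.inr (continuous_inrχq p 1 2)
        (fun _ => rfl) (map_inr_GK_le_GtpY_modelχq' p 1 2 even_two)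
        (map_inr_GKdd_le_GtpYdd_modelχq' p 1 2 even_two)).etaleThetaDataOfClass
        (etaDdχq p 1 2 even_two)).doubleUnderlineχqOfEtaRes p 1 2 l hl (eta_res_etaDdχq p 1 2 even_two l hl)
    let B := BadPlaceSetting.ofUnderline C μ (compat_modelχq p 1 2 even_two)
        (ThetaSetting.modelχq_sec2Hyps p 1 2 even_two) hlp (ne_two_of_four_mul_dvd_pred p l.pos hdvd)
        (ne_of_four_mul_dvd_pred p l.pos hdvd) (exists_isPrimitiveRoot_K_modelχq p 1 2 even_two l.pos hdvd)
        (EtaleThetaDataOfSetting.modN_rootLift_mem_thetaCocycles C (compat_modelχq p 1 2 even_two)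
          (ThetaSetting.modelχq_sec2Hyps p 1 2 even_two) μ)
    (B.PiX : Type) = Huuχq p 1 2 l hl ∧
      (B.PiXplain : Type) = ((ThetaSetting.modelχq p 1 2 even_two).GtpXu l) ∧ B.inclPlain.range.index = l := by
  intro C B
  exact ⟨rfl, rfl, BadPlaceSetting.ofUnderline_index_eq C μ _ _ hlp _ _ _ _⟩

/-- **II:Prop2.1 well-definedness at the Tate model, modulo the ONE tempered-anabelian input (H1)**
`EtaleThetaDataOfSetting.PiYddCharacteristic` AT THE INSTANCE (every topological automorphism of `Π^tp_{X̲̲} = Huuχq`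
stabilises `Π^tp_{Ÿ̲̲}`; [EtTh] Cor. 2.18 (i) form — NOT discharged here, a named residual): any two Prop. 2.1 outputs
over the bad-place setting of the Tate model have the same top row (abc-iut-L6-t19 / w4-d034's
`YL_eq_of_piYddCharacteristic'`; every other argument a theorem of the tree).
[claim: Mochizuki2012, status: disputed] (IUTchII §2 Prop 2.1, kurims p.65) -/
theorem YL_eq_of_piYddCharacteristic_modelTate :
    let C := (((kummerCoreχq p 1 2 even_two).toKummerDataOfSection SemidirectProduct.inr (continuous_inrχq p 1 2)
        (fun _ => rfl) (map_inr_GK_le_GtpY_modelχq' p 1 2 even_two)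
        (map_inr_GKdd_le_GtpYdd_modelχq' p 1 2 even_two)).etaleThetaDataOfClass
        (etaDdχq p 1 2 even_two)).doubleUnderlineχqOfEtaRes p 1 2 l hl (eta_res_etaDdχq p 1 2 even_two l hl)
    let B := BadPlaceSetting.ofUnderline C μ (compat_modelχq p 1 2 even_two)
        (ThetaSetting.modelχq_sec2Hyps p 1 2 even_two) hlp (ne_two_of_four_mul_dvd_pred p l.pos hdvd)
        (ne_of_four_mul_dvd_pred p l.pos hdvd) (exists_isPrimitiveRoot_K_modelχq p 1 2 even_two l.pos hdvd)
        (EtaleThetaDataOfSetting.modN_rootLift_mem_thetaCocycles C (compat_modelχq p 1 2 even_two)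
          (ThetaSetting.modelχq_sec2Hyps p 1 2 even_two) μ)
    EtaleThetaDataOfSetting.PiYddCharacteristic C →
      ∀ {P : TopGroup.{0}} (T₁ T₂ : TemperedCoverings B P), T₁.YL = T₂.YL ∧ T₁.YddL = T₂.YddL := by
  intro C B hH1 P T₁ T₂
  exact TemperedCoverings.YL_eq_of_piYddCharacteristic' C μ _ _ hlp _ _ _ _ hH1 T₁ T₂

/-! ## §4. Census: the hypothesis bundle `Sec2Hyps` and its companions realised TOGETHER at one genuine carrier -/

include hl hdvd in
/-- **SETTING-FREE CENSUS (K-L6, `Sec2Hyps` bundle)**: for every prime `p` and odd prime `l` with `4l ∣ p − 1` and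
every level `N`, SOME [EtTh] §1 theta setting `D` with `D.IsEtThOrigin ∧ D.Sec2Hyps` carries an étale-theta datum `E`
with Prop. 1.5 (iii), a choice `X̲̲`, a cyclotome identification `μ`, a cusp labelling, a primitive `4l`-th root of unity
in `K` and a theta cocycle `η` — i.e. EVERY binder of the [IUTchII] §1 carrier `ThetaSetting.ofDoubleUnderline` — such
that the §1 rows Def. 1.1 (`ModelFrame`, Def. 1.1 output of every mono-theta environment), Prop. 1.2 (i) (existence +
indeterminacy for every `Π ≅ Π^tp_{X̲̲}`) and Prop. 1.2 (ii) (for every tempered-Frobenioid datum and every mono-theta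
environment) hold at it, and the print-level bad-place setting has index `[Π^tp_{X_v} : Π_v] = l`.  Witness: the Tate
model `modelTate p` with the data of §2.  [claim: Mochizuki2012, status: disputed] (IUTchII §1 Prop 1.2 (i), kurims p.25) -/
theorem _root_.Literature.IUT.HodgeArakelov.ThetaSetting.exists_isEtThOrigin_sec2Hyps_carriers_of_dvd_pred
    (N : ℕ+) :
    ∃ (D : Literature.AnabelianGeometry.EtaleTheta.ThetaSetting p) (_ : D.IsEtThOrigin) (hS : D.Sec2Hyps)
      (E : D.EtaleThetaData) (C : E.DoubleUnderline l) (μ : D.CyclotomeMod l N)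
      (h15 : Literature.AnabelianGeometry.EtaleTheta.ThetaSetting.Prop15iii E hS.compat) (L : C.CuspLabels)
      (hp2 : p ≠ 2) (hpl : p ≠ (l : ℕ)) (hζ : ∃ ζ : D.K, IsPrimitiveRoot ζ (4 * l))
      (η : (C.thetaEnvData μ hS.compat hS).PiYdd → MuN p N) (hη : η ∈ (C.thetaEnvData μ hS.compat hS).thetaCocycles),
      Nonempty (ModelFrame (ThetaSetting.ofDoubleUnderline C μ hS.compat hS hlp hp2 hpl hζ hη)
          (C.rigidData μ hS.compat hS h15 L)) ∧
        (∀ M : MonoThetaEnv (ThetaSetting.ofDoubleUnderline C μ hS.compat hS hlp hp2 hpl hζ hη),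
          Nonempty (Def11Output M)) ∧
        (∃ M : MonoThetaEnv (ThetaSetting.ofDoubleUnderline C μ hS.compat hS hlp hp2 hpl hζ hη),
          M.toEtale = (C.thetaEnvData μ hS.compat hS).modelMono hη) ∧
        (∀ (P : TopGroup.{0}),
          Nonempty (P ≃ₜ* (ThetaSetting.ofDoubleUnderline C μ hS.compat hS hlp hp2 hpl hζ hη).PiX) →
            Nonempty (EnvOfGroup (ThetaSetting.ofDoubleUnderline C μ hS.compat hS hlp hp2 hpl hζ hη) P) ∧
              ∃ Env : EnvOfGroup (ThetaSetting.ofDoubleUnderline C μ hS.compat hS hlp hp2 hpl hζ hη) P,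
                Prop12_i_indeterminacy Env.recon) ∧
        (∀ (Fr : TemperedFrobenioidData (ThetaSetting.ofDoubleUnderline C μ hS.compat hS hlp hp2 hpl hζ hη))
            (M : MonoThetaEnv (ThetaSetting.ofDoubleUnderline C μ hS.compat hS hlp hp2 hpl hζ hη)),
          ∃ Env : EnvOfFrobenioid Fr, Env.env = M ∧ Prop12_i_indeterminacy Env.recon) ∧
        (BadPlaceSetting.ofUnderline C μ hS.compat hS hlp hp2 hpl hζ hη).inclPlain.range.index = l := by
  obtain ⟨μ⟩ := modelχq_nonempty_cyclotomeMod p 1 2 even_two l.pos N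
  refine ⟨ThetaSetting.modelχq p 1 2 even_two, ThetaSetting.modelχq_isEtThOrigin p 1 2 even_two,
    ThetaSetting.modelχq_sec2Hyps p 1 2 even_two, _,
    (((kummerCoreχq p 1 2 even_two).toKummerDataOfSection SemidirectProduct.inr (continuous_inrχq p 1 2)
        (fun _ => rfl) (map_inr_GK_le_GtpY_modelχq' p 1 2 even_two)
        (map_inr_GKdd_le_GtpYdd_modelχq' p 1 2 even_two)).etaleThetaDataOfClass
        (etaDdχq p 1 2 even_two)).doubleUnderlineχqOfEtaRes p 1 2 l hl (eta_res_etaDdχq p 1 2 even_two l hl),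
    μ, prop15iii_etaleThetaDataOfClass_etaDdχq p _ SemidirectProduct.inr (continuous_inrχq p 1 2) (fun _ => rfl)
      (map_inr_GK_le_GtpY_modelχq' p 1 2 even_two) (map_inr_GKdd_le_GtpYdd_modelχq' p 1 2 even_two),
    ⟨fun _ => ∅, fun _ => ∅, fun _ => rfl⟩, ne_two_of_four_mul_dvd_pred p l.pos hdvd,
    ne_of_four_mul_dvd_pred p l.pos hdvd, exists_isPrimitiveRoot_K_modelχq p 1 2 even_two l.pos hdvd, _,
    EtaleThetaDataOfSetting.modN_rootLift_mem_thetaCocycles _ _ _ μ, ?_, ?_, ?_, ?_, ?_, ?_⟩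
  · exact nonempty_modelFrame_modelTate p l hl hlp hdvd μ
  · exact nonempty_def11Output_modelTate p l hl hlp hdvd μ
  · exact nonempty_monoThetaEnv_modelTate p l hl hlp hdvd μ
  · exact fun P hP => ⟨nonempty_envOfGroup_modelTate p l hl hlp hdvd μ P hP,
      exists_envOfGroup_indeterminacy_modelTate p l hl hlp hdvd μ P hP⟩
  · exact exists_envOfFrobenioid_indeterminacy_modelTate p l hl hlp hdvd μ
  · exact (ofUnderline_PiX_index_modelTate p l hl hlp hdvd μ).2.2

end ModelTateCarriers

end Literature.IUT.HodgeArakelov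

end
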